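import Mathlib
import Literature.Computability.Complexity.CircuitClasses
import Literature.Computability.MetaComplexity.CircuitMagnification
import Literature.Computability.MetaComplexity.FormulaModelsAE
import Literature.Computability.MetaComplexity.ChenJinWilliams2019.SparseMagnification
import Literature.Computability.MetaComplexity.ChenJinWilliams2020.ProbabilisticFormulas
import HarnessLib

/-!
# Chen–Jin–Williams STOC 2020, Theorem 1.3 item 3: sparse `NP` languages vs `n^{2+ε}`-size
# probabilistic formulas, as a named fact

Literature: L. Chen, C. Jin, R. R. Williams, *Sharp threshold results for computational complexity*,
STOC 2020, 1335–1348, doi:10.1145/3357713.3384283 [bib: `ChenJinWilliams2020`], p. 3 (Theorem 1.3):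

> *"3. If there is an ε > 0 and a family of languages {L_β} (indexed over β ∈ (0, 1)) such that L_β
> is a 2^{n^β}-sparse NP language and for all β L_β does not have n^{2+ε}-size probabilistic
> formulas, then NP does not have n^k-size formulas, for all k."*

with Definition 1.1 (p. 3): *"A probabilistic formula is a distribution F over De Morgan formulas. We
say F computes a function f, if for all x, Pr_{F∼F}[F(x) = f(x)] ≥ 2/3."*

## Rendering (each choice weaker-or-equal to print)

* "`2^{n^β}`-sparse" = `ChenJinWilliams2019.IsSparse (expSparsity β)` (`≤ ⌊2^{n^β}⌋` members at each
  length), exactly as in the FOCS 2019 companion file `SparseMagnification.lean`.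
* "does not have `n^{2+ε}`-size probabilistic formulas" = `∉ PFORMULAae third (thresholdBound13 ε)`:
  no distribution over De Morgan formulas of eventually at most `⌈N^{2+ε}⌉` leaves computes the
  language with error `≤ 1/3` at all large lengths (the classes and the bound of typer1's
  `ProbabilisticFormulas.lean`, Theorem 1.3(1)); the negated a.e. class is the weaker hypothesis.
* The family `{L_β}` indexed over `β ∈ (0,1)` is `∀ β ∈ (0,1), ∃ L, …` (choice).
* "NP does not have `n^k`-size formulas, for all k" = `∀ k, ∃ L ∈ NP, L ∉ FORMULAae (n ↦ n^k)`
  (De Morgan leaf size, a.e.): under any sensible reading of print (`O(n^k)`, or exact `n^k` at all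
  large `n`) the printed conclusion for `k + 1` implies the typed one for `k`, since `FORMULAae`
  absorbs finitely many lengths and `c·n^k ≤ n^{k+1}` eventually.

Census (cell `pub-magnif`, typer2): the "sparse NP languages × probabilistic formulas" row — T typed
here (`thm13_3`, gap Prop `Hypothesis13S`); K: for each FIXED `β` a `2^{n^β}`-sparse NP language
without `n^{2+β'−ε}`-size probabilistic formulas (`β' < β`) is given by Theorem 1.6 applied to
`MCSP[n^{β'}]` (`ChenJinWilliams2020.thm16`; census row R15), so, as for R15, the open content is the
ORDER OF QUANTIFIERS (`∃ ε ∀ β` needed vs `∀ β ∃ ε` known) — recorded as text; typing that comparison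
would additionally need `MCSP ∈ NP` and the circuit-counting sparsity bound as tree lemmas.
-/

namespace Literature.Computability.MetaComplexity.ChenJinWilliams2020

open scoped ENNReal
open Literature.Computability.Complexity Literature.Computability.Complexity.Nondeterministic
open Literature.Computability.MetaComplexity ChenJinWilliams2019

/-- **One `ε`-instance of the hypothesis of Theorem 1.3(3)**: for every `β ∈ (0,1)` some
`2^{n^β}`-sparse `NP` language has no probabilistic De Morgan formulas of `⌈N^{2+ε}⌉` leaves
(error `1/3`, a.e.). [cite: ChenJinWilliams2020, Thm. 1.3(3) (hypothesis)] -/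
def SparsePFormulaHardAt (ε : ℝ) : Prop :=
  ∀ β : ℝ, 0 < β → β < 1 →
    ∃ L : Language Bool, L ∈ NP ∧ IsSparse (expSparsity β) L ∧
      L ∉ PFORMULAae third (thresholdBound13 ε)

/-- **Hypothesis of Theorem 1.3(3)** (OPEN — census, sparse-NP × probabilistic-formulas row):
*"there is an ε > 0 and a family of languages {L_β} (indexed over β ∈ (0, 1)) such that L_β is a
2^{n^β}-sparse NP language and for all β L_β does not have n^{2+ε}-size probabilistic formulas"*.
[cite: ChenJinWilliams2020, Thm. 1.3(3) (hypothesis)] -/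
def Hypothesis13S : Prop :=
  ∃ ε : ℝ, 0 < ε ∧ SparsePFormulaHardAt ε

/-- **`NP` does not have `n^k`-size formulas, for all `k`**: for every `k` some `NP` language is
outside `FORMULAae (n ↦ n^k)` (De Morgan leaf size, a.e.).
[cite: ChenJinWilliams2020, Thm. 1.3(3) (conclusion)] -/
def NPNotInFixedPolyFormulas : Prop :=
  ∀ k : ℕ, ∃ L : Language Bool, L ∈ NP ∧ L ∉ FORMULAae fun n => n ^ k

/-- **Chen–Jin–Williams, Theorem 1.3(3)** as a named fact: *"If there is an ε > 0 and a family of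
languages {L_β} (indexed over β ∈ (0, 1)) such that L_β is a 2^{n^β}-sparse NP language and for
all β L_β does not have n^{2+ε}-size probabilistic formulas, then NP does not have n^k-size
formulas, for all k."* Proof in the source: §5.1 (kernelization of [CJW19] + the `#SAT` algorithm
for `n^{2−ε}`-size probabilistic formulas with small-fan-in oracle leaves, Theorem 4.1). Users take
`(h : thm13_3)`. [cite: ChenJinWilliams2020, Thm. 1.3(3)] -/
def thm13_3 : Prop :=
  Hypothesis13S → NPNotInFixedPolyFormulas

/-! ### API -/

/-- Consequence shape of Theorem 1.3(3). [cite: ChenJinWilliams2020, Thm. 1.3(3)] -/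
theorem npNotInFixedPolyFormulas_of_sparse (h : thm13_3) {ε : ℝ} (hε : 0 < ε)
    (hs : SparsePFormulaHardAt ε) : NPNotInFixedPolyFormulas :=
  h ⟨ε, hε, hs⟩

/-- The hypothesis is antitone in `ε` (a larger exponent is a stronger formula class to beat).
[folklore] -/
theorem SparsePFormulaHardAt.anti {ε ε' : ℝ} (hε : ε ≤ ε') (h : SparsePFormulaHardAt ε') :
    SparsePFormulaHardAt ε := by
  intro β hβ hβ1
  obtain ⟨L, hNP, hsp, hL⟩ := h β hβ hβ1
  refine ⟨L, hNP, hsp, fun hmem => hL (PFORMULAae_mono (fun _ => le_rfl) ⟨1, fun n hn => ?_⟩ hmem)⟩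
  unfold thresholdBound13
  exact Nat.ceil_le_ceil (Real.rpow_le_rpow_of_exponent_le (by exact_mod_cast hn) (by linarith))

end Literature.Computability.MetaComplexity.ChenJinWilliams2020
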